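import Summits.BirchSwinnertonDyer.BirchSwinnertonDyer.Theorems.ClassRecordThreeCornerTwinLowerModEightDefs
import HarnessLib

/-!
# Routes `ClassRecordThree` ∕ `KolyvaginRoadThree` (rung K2@3), crux `CornerAtThreeW` (item stmt-BirchSwinnertonDyer-21420; 19111 aside),
# conjunct (U), MONO-carrier branch: corner-p1 g12's Jetchev-MAX END RE-KEYED on the twin's `≥`-half at ONE `d_K ≡ 1 (mod 8)` frame
# (`CornerTwinHalves.CornerTwinLowerModEightAt`) instead of the ∀-twist conjunct `CornerTwistAt W`
# (cell `bsd-stepL`, seat `bsd-stepL-corner3-p2` g6 = WIDTH-LEVER lane B; `--supports stmt-BirchSwinnertonDyer-21420 --as helper`)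

THEOREMS ONLY (no definition, no named fact, no `sorry`). WHY: the END of record (`…CornerAtThreeUpperModEightConsumed`,
`Three.missingUpperBoundAt_monoCarrier_of_threeNamedFacts_of_facts`, p575586) books a Hoffstein–Luo frame with `d_K ≡ 1 (mod 8)` and consumes the
corner's ∀-twist conjunct there — through the twin's `≥`-half ONLY. Supplying that half WITH the frame (`CornerTwinLowerModEightAt W`, lane B g6 Defs)
removes the ∀-twist input from the mono branch: (i) the witness-shaped line of plan g38's RULING 40 (α) then composes with ONE witness stub (the
witness frame need not be `≡ 1 (mod 8)`); (ii) on the line of record the mono branch's open input drops from «`BSD₃` of every odd Heegner twist» to a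
per-pair certifiable supply (exact twin at a `d ≡ 1 (mod 8)` frame: mult-p3 census 296 ∕ 296 + 61 ∕ 61 odd `N`), and on even `N` to conjunct 4 itself.
Three theorems = the three of p575586 §2–§3 with (`hHL`, `hTw`) ↦ `hF8`; proofs otherwise VERBATIM.

HONEST FRAMING: CONDITIONAL on NAMED, published, typed, unformalised facts (Gross 3.7 (2) ∕ Nekovář 4.13 (ii); Poitou–Tate for the tree's Selmer
structures; GZ86 III (3.1); Cha 2005 Rmk. 25) and on the supplied twin half; no stub is discharged; 19111 ∕ 21420 stay OPEN; nothing about any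
curve's BSD; T7. Credit: corner-p1 g10–g12 (the whole chain), print-x9, ARM P r05, mult-p3 (census).
References (locators only): [cite: GrossLMS1991, Prop. 3.7 (2) (p. 240)] [cite: Nekovar2007, Prop. 4.13 (ii)] [cite: Marcus2018, Ch. 3 Thm. 25]
[cite: Jetchev2008, Thm. 1.4, §5–§6] [cite: McCallumLMS1991, §3 Cor. 3.2, §4 Prop. 4.4, §5 Prop. 5.2] [cite: GrossZagier1986, III (3.1)]
[cite: MilneADT2006, Ch. I, Thm. 4.10(b)] [cite: Cha2005, Rmk. 25].
-/

set_option autoImplicit false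
set_option linter.dupNamespace false -- `Summit.BirchSwinnertonDyer.BirchSwinnertonDyer` (summit = problem), tree-wide

noncomputable section

open scoped Classical NumberField

namespace Summit.BirchSwinnertonDyer.Rank1Residual.X11b.Three

open WeierstrassCurve IsDedekindDomain NumberField Literature.NumberTheory.EllipticCurves
  Literature.NumberTheory.EllipticCurves.ModularForms
  Literature.NumberTheory.EllipticCurves.Rank1Residual
  Literature.NumberTheory.EllipticCurves.Rank1Residual.Typed
  Literature.NumberTheory.GaloisRepresentations Literature.NumberTheory.GaloisCohomology
  Summit.BirchSwinnertonDyer.Rank1Residual Summit.BirchSwinnertonDyer.Rank1Residual.X11b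

/-- **`Typed.MissingUpperBoundAt W 3` on a (T4″)@3 corner curve from the Jetchev direction AT A SUPPLIED FRAME with `d_K ≡ 1 (mod 8)`**
(`hJW8`: on every Manin-good conductor-`N_E` frame over an imaginary quadratic Heegner field with `d_K` odd AND `d_K ≡ 1 (mod 8)`, every derived
Heegner point at Kolyvagin levels of index `≥ s` is `3^s`-divisible for all `s ≤ ord₃ ∏c`), together with the twin's `≥`-half at ONE such frame
(`hF8 : CornerTwinHalves.CornerTwinLowerModEightAt W`). Corner-p1 g12's `missingUpperBoundAt_of_jetchevMaxModEightAt_of_irreducible` VERBATIM except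
that the frame is the SUPPLIED one (its Manin-good datum from `exists_maninDatum_of_odd` at that field) instead of Hoffstein–Luo's
(`exists_modEightHeegnerData`), and the twin's `≥`-half is read from `hF8` instead of `pPartRankZero_of_cornerTwistAt … |>.le`. PUBLISHED binders:
Gross–Zagier, Kolyvagin, GZK, modularity, Mazur–Manin, Shimura reciprocity at conductor 1, Darmon 2004 Thm. 3.6, the structure fact `hChaU`.
CONDITIONAL on all of them, on `hJW8` and on `hF8`; nothing booked.
-- adapted from Summits/BirchSwinnertonDyer/BirchSwinnertonDyer/Theorems/ClassRecordThreeCornerAtThreeUpperModEightConsumed.lean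
[cite: Cha2005, Thm. 21, Rmk. 25] [cite: Darmon2004, Thm. 3.6] [cite: Jetchev2008, Cor. 1.5 (shape)] [cite: Mazur1978, Cor. 4.1]
[cite: JetchevSkinnerWan2017, §7.4.2 (eq:shaupper)] -/
theorem missingUpperBoundAt_of_jetchevMaxModEightAt_of_twinLowerModEight [Fact (Nat.Prime 3)]
    (hGZ : ∀ (N : ℕ) [NeZero N] (W : WeierstrassCurve ℚ) (K : Type) [Field K] [NumberField K],
      gross_zagier N W K)
    (hKo : ∀ (N : ℕ) [NeZero N] (W : WeierstrassCurve ℚ) (K : Type) [Field K] [NumberField K],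
      kolyvagin N W K)
    (hGZK : rank_eq_analyticRank_of_analyticRank_le_one) (hmod : hasEntireLFunction_rat)
    (hnf : exists_isNewformOf)
    (hMaz : mazur_not_dvd_maninConstant_of_odd)
    (hrec : ∀ (N : ℕ) [NeZero N] (W : WeierstrassCurve ℚ) (K : Type) [Field K] [NumberField K],
      heegnerPointOfConductor_one_galoisConj N W K)
    (hD36 : ∀ (N : ℕ) [NeZero N] (W : WeierstrassCurve ℚ) (K : Type) [Field K] [NumberField K],
      phi_heegnerTau_mem_singularModuliField N W K)
    (hChaU : Cha2005.rmk25_padicValNat_card_sha_primary_add_le_of_globalDivisibility)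
    (W : WeierstrassCurve ℚ) [W.IsElliptic] [W.IsGloballyMinimal] (hX : ClassX11b W 3)
    (hns : ¬ Surj W 3)
    (hJW8 : ∀ [NeZero (W.conductorNorm ℤ)] (K : Type) [Field K] [NumberField K]
      (Dt : ModularParametrizationData W (W.conductorNorm ℤ)) (β : ℤ) (ι : K →+* ℂ),
      ClassX11b W 3 → ¬ Surj W 3 →
      IsImaginaryQuadratic K → SatisfiesHeegnerHypothesis (W.conductorNorm ℤ) K →
      Odd (NumberField.discr K) → NumberField.discr K % 8 = 1 →
      (4 * (W.conductorNorm ℤ : ℤ)) ∣ β ^ 2 - NumberField.discr K → ¬ (3 : ℤ) ∣ Dt.c →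
      ∀ (s : ℕ), s ≤ padicValNat 3 W.tamagawaProduct →
        ∀ (n : ℕ) (d : KolyvaginHeegnerData Dt β ι n), Squarefree n →
          (∀ ℓ ∈ n.primeFactors, Zhang2014.IsKolyvaginPrime (W.conductorNorm ℤ) W K 3 ℓ ∧
            s ≤ Zhang2014.kolyvaginIndex W 3 ℓ) → Koly.PDiv d 3 s)
    (hF8 : Summit.BirchSwinnertonDyer.BirchSwinnertonDyer.Theorems.CornerTwinHalves.CornerTwinLowerModEightAt W) :
    Typed.MissingUpperBoundAt W 3 := by
  have hNS : integral_neronScaling_of_isGloballyMinimal :=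
    integral_neronScaling_of_isGloballyMinimal_holds
  obtain ⟨hr, hp2, hmult, hirr⟩ := id hX
  haveI : NeZero (W.conductorNorm ℤ) := ⟨(W.conductorNorm_pos_holds).ne'⟩
  -- the SUPPLIED frame: odd Heegner twin frame with `d_K ≡ 1 (mod 8)` and the twin's `≥`-half
  obtain ⟨K, _, _, Wd, _, _, Cd, ⟨hK, hodd, hlt, hHN, hH3, hLt, hWd⟩, hd8, qd, hqd, hv⟩ := hF8 hX hns
  have hpd : ¬ ((3 : ℕ) : ℤ) ∣ NumberField.discr K := not_dvd_discr_of_split hK Nat.prime_three hp2 hH3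
  have hμ : ¬ 3 ∣ Units.torsionOrder K := by
    haveI : IsTotallyComplex K := hK.2
    rw [Literature.NumberTheory.DiophantineGeometry.torsionOrder_eq_two_of_discr_lt hK.1 hlt]
    omega
  -- the Manin-good Heegner datum at THIS field (Mazur 1978 Cor. 4.1 + Darmon 2004 Thm. 3.6)
  obtain ⟨Dt, H, ι, P, hP, hc⟩ :=
    exists_maninDatum_of_odd hnf hMaz hNS W 3 (W.conductorNorm ℤ) K rfl hp2 hmult hirr hK hHN
  have htam : padicValNat 3 Wd.tamagawaProduct = padicValNat 3 W.tamagawaProduct :=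
    X2.padicValNat_tamagawaProduct_twist_of_heegner_of_odd W 3 hp2 K hK hodd hpd hHN Cd hWd
  have hu : padicValRat 3 (Cd.u : ℚ) = 0 :=
    padicValRat_u_eq_zero_of_twist_minimal W 3 K hK hHN hmult Cd hWd
  refine missingUpperBoundAt_of_shaIndexBound_sharp W 3 (W.conductorNorm ℤ) K Dt H ι P (hGZ _ W K)
    (hKo _ W K) hGZK hmod hK hHN hP hp2 hc hμ hr hLt Wd Cd hWd hu htam le_rfl ⟨qd, hqd, hv⟩ ?_
  -- the SHARP bound over `K` at THIS frame, from the Jetchev direction at this frame (`d_K ≡ 1 (mod 8)`)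
  intro hfin hPinf
  haveI : Finite (W.baseChange K).sha := hfin
  -- `d_K ≠ −3` (`3 ∣ N_E` splits in `K`) and `d_K ≠ −4` (`d_K` odd)
  have h3N : 3 ∣ W.conductorNorm ℤ := dvd_conductorNorm_of_classX11b hX
  have hpd' : ¬ ((3 : ℕ) : ℤ) ∣ NumberField.discr K :=
    not_dvd_discr_of_satisfiesHeegnerHypothesis hK hHN Nat.prime_three h3N
  have h3 : NumberField.discr K ≠ -3 := by
    intro h; apply hpd'; rw [h]; exact ⟨-1, by norm_num⟩
  have h4 : NumberField.discr K ≠ -4 := by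
    intro h; have := Int.odd_iff.mp hodd; omega
  -- a conductor-1 Kolyvagin–Heegner datum on the frame (Dt, H.β, ι) (Darmon 2004, Thm. 3.6)
  obtain ⟨d₁⟩ := exists_kolyvaginHeegnerData_one (hD36 _ W K) hK Dt H.β ι H.dvd_sq_sub
  -- the bottom point: P(1) = y_K = P in E(K̄) (Shimura reciprocity at conductor 1)
  have hPd : d₁.toGeomPoints d₁.derivedPoint = toGeomPoints (W.baseChange K) P :=
    KolyvaginBottom.toGeomPoints_derivedPoint_one_eq (hrec _ W K) hK hHN hP d₁ rfl
  -- rank one (Kolyvagin) and no 3-torsion (E[3] irreducible, K imaginary quadratic)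
  obtain ⟨hrank, -⟩ := hKo (W.conductorNorm ℤ) W K hK hHN ⟨Dt, H, ι, hP⟩ hPinf
  have hbot := torsionBy_eq_bot_of_isImaginaryQuadratic_of_hasIrreducibleModPGaloisRep W K hK
    Nat.prime_three hirr
  have hiv : ∀ x : (W.baseChange K).toAffine.Point, 3 • x = 0 → x = 0 := fun x hx ↦ by
    have hmem : x ∈ AddSubgroup.torsionBy (W.baseChange K).toAffine.Point ((3 : ℕ) : ℤ) := by
      rw [mem_torsionBy_iff, natCast_zsmul]
      exact hx
    rw [hbot] at hmem
    exact hmem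
  exact Koly.shaIndexBound_sharp_of_globalDivisibility_of_irreducible hChaU W K 3 (by norm_num) hmult hirr hK
    h3 h4 hHN Dt H.β ι d₁ P hPd hPinf hrank hiv
    (hJW8 K Dt H.β ι hX hns hK hHN hodd hd8 H.dvd_sq_sub hc)

/-- **MONO-carrier corner curves: `Typed.MissingUpperBoundAt W 3` from the Jetchev MAX form on `d_K ≡ 1 (mod 8)` frames** (`hmaxW8`:
for every carrier `v` and `s ≤ ord₃ c_v`, on such frames, `P_n ∈ 3^s E(K_n)` at Kolyvagin levels of index `≥ s`) and the twin's `≥`-half at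
ONE such frame (`hF8 : CornerTwinHalves.CornerTwinLowerModEightAt W`): if one place carries the whole `3`-part of `∏c` (`hmono`), the MAX form at
it is the full depth. Corner-p1 g12's `missingUpperBoundAt_of_jetchevMaxModEightAt_of_monoCarrier` with (`hHL`, `hTw`) ↦ `hF8`. CONDITIONAL on
`hmaxW8`, `hmono`, `hF8` and the cited facts; nothing booked. [cite: Jetchev2008, Thm. 1.4, Cor. 1.5 (shape)] -/
theorem missingUpperBoundAt_of_jetchevMaxModEightAt_of_monoCarrier_of_twinLowerModEight [Fact (Nat.Prime 3)]
    (hGZ : ∀ (N : ℕ) [NeZero N] (W : WeierstrassCurve ℚ) (K : Type) [Field K] [NumberField K],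
      gross_zagier N W K)
    (hKo : ∀ (N : ℕ) [NeZero N] (W : WeierstrassCurve ℚ) (K : Type) [Field K] [NumberField K],
      kolyvagin N W K)
    (hGZK : rank_eq_analyticRank_of_analyticRank_le_one) (hmod : hasEntireLFunction_rat)
    (hnf : exists_isNewformOf)
    (hMaz : mazur_not_dvd_maninConstant_of_odd)
    (hrec : ∀ (N : ℕ) [NeZero N] (W : WeierstrassCurve ℚ) (K : Type) [Field K] [NumberField K],
      heegnerPointOfConductor_one_galoisConj N W K)
    (hD36 : ∀ (N : ℕ) [NeZero N] (W : WeierstrassCurve ℚ) (K : Type) [Field K] [NumberField K],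
      phi_heegnerTau_mem_singularModuliField N W K)
    (hChaU : Cha2005.rmk25_padicValNat_card_sha_primary_add_le_of_globalDivisibility)
    (W : WeierstrassCurve ℚ) [W.IsElliptic] [W.IsGloballyMinimal] (hX : ClassX11b W 3)
    (hns : ¬ Surj W 3)
    (hmono : ∃ v : HeightOneSpectrum (𝓞 ℚ),
      padicValNat 3 W.tamagawaProduct ≤ padicValNat 3 (W.tamagawaNumberAt v))
    (hmaxW8 : ∀ [NeZero (W.conductorNorm ℤ)] (K : Type) [Field K] [NumberField K]
      (Dt : ModularParametrizationData W (W.conductorNorm ℤ)) (β : ℤ) (ι : K →+* ℂ),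
      ClassX11b W 3 → ¬ Surj W 3 →
      IsImaginaryQuadratic K → SatisfiesHeegnerHypothesis (W.conductorNorm ℤ) K →
      Odd (NumberField.discr K) → NumberField.discr K % 8 = 1 →
      (4 * (W.conductorNorm ℤ : ℤ)) ∣ β ^ 2 - NumberField.discr K → ¬ (3 : ℤ) ∣ Dt.c →
      ∀ (v : HeightOneSpectrum (𝓞 ℚ)) (s : ℕ), s ≤ padicValNat 3 (W.tamagawaNumberAt v) →
        ∀ (n : ℕ) (d : KolyvaginHeegnerData Dt β ι n), Squarefree n →
          (∀ ℓ ∈ n.primeFactors, Zhang2014.IsKolyvaginPrime (W.conductorNorm ℤ) W K 3 ℓ ∧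
            s ≤ Zhang2014.kolyvaginIndex W 3 ℓ) → Koly.PDiv d 3 s)
    (hF8 : Summit.BirchSwinnertonDyer.BirchSwinnertonDyer.Theorems.CornerTwinHalves.CornerTwinLowerModEightAt W) :
    Typed.MissingUpperBoundAt W 3 := by
  refine missingUpperBoundAt_of_jetchevMaxModEightAt_of_twinLowerModEight hGZ hKo hGZK hmod hnf hMaz hrec hD36 hChaU W
    hX hns ?_ hF8
  intro _ K _ _ Dt β ι hX hns hK hHN hodd hd8 hβ hc s hs n d hn hℓ
  obtain ⟨v, hv⟩ := hmono
  exact hmaxW8 K Dt β ι hX hns hK hHN hodd hd8 hβ hc v s (hs.trans hv) n d hn hℓ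

/-- **END: on every MONO-carrier (T4″)@3 corner curve, `Typed.MissingUpperBoundAt W 3` ⟸ {(A′) Gross 1991 Prop. 3.7 (2) =
`GrossLMS1991.prop37_2_frobeniusCongruence`, Poitou–Tate for the tree's Selmer structures (five-conjunct form), [GZ86 III (3.1)] image-free} ∪ the
consumer's cited facts ∪ {`CornerTwinHalves.CornerTwinLowerModEightAt W`}** — corner-p1 g12's END
`missingUpperBoundAt_monoCarrier_of_threeNamedFacts_of_facts` with its ∀-twist input `CornerTwistAt W` (rank-0 `BSD₃` of EVERY odd Heegner twist)
replaced by the ONE thing it used of it: the twin's `≥`-half at a `d_K ≡ 1 (mod 8)` frame — now SUPPLIED (`hF8`; FREE at an exact twin; per pair a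
finite certificate; on even `N` implied by conjunct 4's `FHTwinLowerSupplyAt W 3`, `CornerTwinHalves.cornerTwinLowerModEightAt_of_fhTwinLowerSupplyAt_of_two_dvd`);
Hoffstein–Luo `hHL` is no longer an input (the frame comes with `hF8`). The mono branch of `residual3_of_stubs` for the witness-shaped line of
RULING 40 (α) and for the line of record alike. CONDITIONAL on every binder; no stub is discharged; 21420 stays OPEN; nothing about any curve's BSD; T7.
-- adapted from Summits/BirchSwinnertonDyer/BirchSwinnertonDyer/Theorems/ClassRecordThreeCornerAtThreeUpperModEightConsumed.lean
[cite: GrossLMS1991, Prop. 3.7 (2) (p. 240)] [cite: Nekovar2007, Prop. 4.13 (ii)] [cite: Jetchev2008, Thm. 1.4, Cor. 1.5]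
[cite: McCallumLMS1991, §4 Prop. 4.4, §5 Prop. 5.2] [cite: GrossZagier1986, III (3.1)] [cite: MilneADT2006, Ch. I, Thm. 4.10(b)] [cite: Cha2005, Rmk. 25] -/
theorem missingUpperBoundAt_monoCarrier_of_threeNamedFacts_of_twinLowerModEight [Fact (Nat.Prime 3)]
    -- the THREE named Literature facts of the Kolyvagin road
    (h37 : GrossLMS1991.prop37_2_frobeniusCongruence)
    (hPTc : ∀ (K : Type) [Field K] [NumberField K], poitouTate_selmerStructure_duality_conj K)
    (hF1 : Gross1991_heegnerPoint_sub_ratTorsion_mem_E0_imageFree)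
    -- the consumer's cited facts
    (hGZ : ∀ (N : ℕ) [NeZero N] (W : WeierstrassCurve ℚ) (K : Type) [Field K] [NumberField K],
      gross_zagier N W K)
    (hKo : ∀ (N : ℕ) [NeZero N] (W : WeierstrassCurve ℚ) (K : Type) [Field K] [NumberField K],
      kolyvagin N W K)
    (hGZK : rank_eq_analyticRank_of_analyticRank_le_one) (hmod : hasEntireLFunction_rat)
    (hnf : exists_isNewformOf)
    (hMaz : mazur_not_dvd_maninConstant_of_odd)
    (hrec : ∀ (N : ℕ) [NeZero N] (W : WeierstrassCurve ℚ) (K : Type) [Field K] [NumberField K],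
      heegnerPointOfConductor_one_galoisConj N W K)
    (hD36 : ∀ (N : ℕ) [NeZero N] (W : WeierstrassCurve ℚ) (K : Type) [Field K] [NumberField K],
      phi_heegnerTau_mem_singularModuliField N W K)
    (hChaU : Cha2005.rmk25_padicValNat_card_sha_primary_add_le_of_globalDivisibility)
    -- the curve: a MONO-carrier (T4″)@3 corner curve, and the twin's `≥`-half at ONE `d_K ≡ 1 (mod 8)` frame
    (W : WeierstrassCurve ℚ) [W.IsElliptic] [W.IsGloballyMinimal] (hX : ClassX11b W 3)
    (hns : ¬ Surj W 3)
    (hmono : ∃ v : HeightOneSpectrum (𝓞 ℚ),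
      padicValNat 3 W.tamagawaProduct ≤ padicValNat 3 (W.tamagawaNumberAt v))
    (hF8 : Summit.BirchSwinnertonDyer.BirchSwinnertonDyer.Theorems.CornerTwinHalves.CornerTwinLowerModEightAt W) :
    Typed.MissingUpperBoundAt W 3 :=
  missingUpperBoundAt_of_jetchevMaxModEightAt_of_monoCarrier_of_twinLowerModEight hGZ hKo hGZK hmod hnf hMaz hrec hD36 hChaU
    W hX hns hmono
    (fun K _ _ Dt β ι hX hns hK hHN hodd hd8 hβ hc v s hs n d hn hℓ ↦
      Koly.pDivThree_of_threeNamedFacts_of_discr_mod_eight h37 hPTc hF1 W K Dt β ι hX hns hK hHN hodd hd8 hβ hc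
        v s hs n d hn hℓ)
    hF8

end Summit.BirchSwinnertonDyer.Rank1Residual.X11b.Three

end
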